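/-
COR-CM (cell pub-hodgecm2, stage 2 of the Hodge ladder) — count-neutral KERNEL COMBINATORICS «THE DICYCLIC LAW for EVERY finite abelian A:
μ(Dic(ℤ/2 × A, c)) = β − 1» (seat prover-pub-hodgecm2-b23-g43-0, binder prover b23, gen 43; claim DICYCLIC-EVEN, HOME/INBOX.md l.10881; blanket
`Census/DicyclicTwist*`).  Theorems only, on top of `Census/DicyclicTwistEvenCount.lean` (this lane, `|A|` even), gen 42's
`Census/DicyclicTwistTransport.lean` (`|A|` odd; the transport `tr`, `gfOf`, `gface_mem`, `card_block_eq` are parity-free and used BY NAME) and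
`Census/DicyclicTwistStabiliser.lean` (the floor for every `A`); no `decide`, no certificate, no named fact, no `sorry`.  `Interfaces.lean` (C1), every
E term, B01, `Transposition/*`, `PortJoin/*` untouched.
HONEST FRAMING: `HC_CM` is NOT proved, here or anywhere in the tree; nothing here is a period, a count of record or a headline.
T5: n/a-class (hypothesis binders: the dicyclic datum, `c * c = 1`, `|A| ≥ 3`); checker: self, 2026-08-23.
-/
import Summits.HodgeConjecture.CorCM.Census.DicyclicTwistEvenCount
import Summits.HodgeConjecture.CorCM.Census.DicyclicTwistTransport
import Summits.HodgeConjecture.CorCM.Census.DicyclicTwistStabiliser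
import Summits.HodgeConjecture.CorCM.Census.DicyclicTwistBlockCountEven

/-!
# THE DICYCLIC LAW: `μ(G, c) = β(G, c) − 1` for every `(G, c)` carrying a dicyclic datum over ANY finite abelian group `A` with `|A| ≥ 3`

For a finite group `G` with a central involution `c` and a dicyclic datum `D : Datum G c A` (`G ≅ Dic(ℤ/2 × A, c) = ⟨ℤ/2 × A, x | x h x⁻¹ = h⁻¹,
x² = c⟩` — every generalised dicyclic group `Dic(H, c)` whose distinguished involution is not a square in `H`), the least number of abstract rank-four
faces whose base changes, together with the pairs, span the Hodge lattice `hodgeSpan c` is EXACTLY `#Block c − 1`: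

* §1 **TRANSPORT of a generating family** (`exists_gfaces_generate_of_family`): gen 42's §6 of `Census/DicyclicTwistTransport.lean` run on an
  abstract family of model face classes (the conclusion of `exists_generating_family` / `exists_generating_family_even`);
* §2 **EXISTENCE for `|A|` even** (`exists_gfaces_generate_even`, from part IX of this lane) and for every `A` (`exists_gfaces_generate'`: odd by
  gen 42, even by this lane);
* §3 **THE LAW** (`isLeast_card_gfaces_generate'`): with the floor of `Census/DicyclicTwistStabiliser.lean` (`le_of_mem_generating`: the
  type-stabiliser subgroup is `ℤ/2 × A`, so `d₂ = 1` and seat b09's coinvariant floor gives `|S| + 1 ≥ β` for every `A`) the least size is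
  `β − 1`; `exists_gfaces_generate_card_eq'` packages an exact family.

* §4 rows: `A = ℤ/4` (`G = ℤ/4 ⋊ ℤ/4` of order `16`): EXACTLY `18` (`isLeast_card_gfaces_generate_eighteen`); `A = ℤ/6` (`G ≅ Dic₃ × ℤ/2` of
  order `24`, `c = x²`; `β = 178`, `card_block_eq_oneHundredSeventyEight`): EXACTLY `177` (`isLeast_card_gfaces_generate_oneHundredSeventySeven`).

Census dictionary: for every Galois CM field whose group is generalised dicyclic over `ℤ/2 × A` (degree `4|A|`; e.g. `ℤ/4 ⋊ ℤ/4`-fields of degree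
`16` for `A = ℤ/4`, `β = 19`, so `18` faces) the Hodge ring of the whole slice is generated modulo divisor classes by the Galois conjugates of
exactly `β − 1` rank-four face classes, and no fewer Hodge generators of any kind exist modulo pairs.  `HC_CM` is NOT proved; nothing here is a
period.  All [folklore].

## References
* [Pohlmann1968] H. Pohlmann, Algebraic cycles on abelian varieties of complex multiplication type, Ann. of Math. 88 (1968), Thm 1.
* [Milne1999] J. S. Milne, Lefschetz motives and the Tate conjecture, Compositio Math. 117 (1999), Prop. 2.1, p. 54.
-/

namespace Summit.HodgeConjecture.CorCM.Census.DicyclicTwist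

open Finset
open Summit.HodgeConjecture.CorCM.Prior.AllgGroup.RfwfAllgGroup
open Summit.HodgeConjecture.CorCM.Census.BlockParity
open Summit.HodgeConjecture.CorCM.Census.Coinvariant
open Summit.HodgeConjecture.CorCM.Census.OddSliceFacesModel

noncomputable section

section General

variable {G : Type*} [Group G] [Fintype G] [DecidableEq G] {c : G}
variable {A : Type} [AddCommGroup A] [Fintype A] [DecidableEq A]
variable (D : Datum G c A)

/-! ## §1 Transport of a generating family of the model -/

include D in
/-- **Transport of a generating family.**  If `fam` is a finite family of model face classes of the three shapes whose `G`-translates together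
with the pairs span `H₂`, then the attached abstract faces `gfOf D f` (`f ∈ fam`) have base changes spanning `hodgeSpan c` together with the
pairs, and there are at most `#fam` of them. [folklore] -/
theorem exists_gfaces_generate_of_family (hc2 : c * c = 1) {fam : Finset (Ty₂ A → ℤ)} {k : ℕ} (hcard : fam.card + 1 ≤ k)
    (hshape : ∀ f ∈ fam, (∃ (φ : Ty A) (i j : A) (ψ : Ty A), i ≠ j ∧ (f = faceVec₀ A φ i j ψ ∨ f = faceVec₁ A ψ φ i j)) ∨
      ∃ (φ : Ty A) (i : A) (ψ : Ty A) (j : A), f = faceVecM A φ i ψ j)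
    (hgen : pairs₂ A ⊔ Submodule.span ℤ {v | ∃ f ∈ fam, ∃ g : ZMod 2 × A, v = translH A g f ∨ v = translH A g (translX A f)} = hodge₂ A) :
    ∃ S' : Finset (CMF G c →₀ ℤ), ↑S' ⊆ gfaceSet G c hc2 ∧ S'.card + 1 ≤ k ∧
      hodgeSpan c hc2 ≤ Submodule.span ℤ (pairSet c) ⊔ Submodule.span ℤ (translates c S') := by
  have hmap : (hodge₂ A).map (tr D : (Ty₂ A → ℤ) →ₗ[ℤ] (CMF G c →₀ ℤ)) ≤
      Submodule.span ℤ (pairSet c) ⊔ Submodule.span ℤ (translates c (fam.image (gfOf D hc2))) := by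
    rw [← hgen, Submodule.map_sup, map_pairs₂]
    refine sup_le le_sup_left ?_
    rw [Submodule.map_span, Submodule.span_le]
    rintro _ ⟨v, ⟨f, hf, g, hv⟩, rfl⟩
    obtain ⟨hS, hp⟩ := gfOf_spec D hc2 (hshape f hf)
    have hmem : gfOf D hc2 f ∈ fam.image (gfOf D hc2) := Finset.mem_image_of_mem _ hf
    have hdec : ∀ Q : G, Finsupp.mapDomain (rt c Q) (tr D f) ∈
        Submodule.span ℤ (pairSet c) ⊔ Submodule.span ℤ (translates c (fam.image (gfOf D hc2))) := fun Q => by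
      have e : tr D f = gfOf D hc2 f + (tr D f - gfOf D hc2 f) := by abel
      rw [e, Finsupp.mapDomain_add]
      exact Submodule.add_mem _ (Submodule.mem_sup_right (Submodule.subset_span ⟨Q, _, hmem, rfl⟩))
        (Submodule.mem_sup_left (mapDomain_rt_mem_span_pairSet D Q hp))
    rcases hv with rfl | rfl
    · rw [LinearEquiv.coe_coe, tr_translH]; exact hdec _
    · rw [LinearEquiv.coe_coe, tr_translH_translX]; exact hdec _
  refine ⟨fam.image (gfOf D hc2), ?_, ?_, ?_⟩
  · intro y hy
    obtain ⟨f, hf, rfl⟩ := Finset.mem_image.mp (Finset.mem_coe.mp hy)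
    exact (gfOf_spec D hc2 (hshape f hf)).1
  · have h2 := Finset.card_image_le (s := fam) (f := gfOf D hc2)
    omega
  · refine sup_le (Submodule.span_le.mpr ?_) le_sup_left
    rintro y ⟨Φ, t, t', ht', rfl⟩
    have h := gface_mem D hc2 Φ ht' (A := A)
    exact (sup_le hmap le_sup_left) h

/-! ## §2 Existence for `|A|` even, and for every `A` -/

include D in
/-- **`μ(G, c) ≤ β(G, c) − 1` for `|A|` EVEN `≥ 3`** (part IX transported). [folklore] -/
theorem exists_gfaces_generate_even (hc2 : c * c = 1) (hev : Even (Fintype.card A)) (h3 : 3 ≤ Fintype.card A) :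
    ∃ S' : Finset (CMF G c →₀ ℤ), ↑S' ⊆ gfaceSet G c hc2 ∧ S'.card + 1 ≤ Fintype.card (BlockParity.Block c) ∧
      hodgeSpan c hc2 ≤ Submodule.span ℤ (pairSet c) ⊔ Submodule.span ℤ (translates c S') := by
  obtain ⟨fam, hcard, hshape, hgen⟩ := exists_generating_family_even A hev h3
  rw [card_block_eq D]
  exact exists_gfaces_generate_of_family D hc2 hcard hshape hgen

include D in
/-- **`μ(G, c) ≤ β(G, c) − 1` for EVERY finite abelian `A` with `|A| ≥ 3`** (odd: gen 42; even: this lane). [folklore] -/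
theorem exists_gfaces_generate' (hc2 : c * c = 1) (h3 : 3 ≤ Fintype.card A) :
    ∃ S' : Finset (CMF G c →₀ ℤ), ↑S' ⊆ gfaceSet G c hc2 ∧ S'.card + 1 ≤ Fintype.card (BlockParity.Block c) ∧
      hodgeSpan c hc2 ≤ Submodule.span ℤ (pairSet c) ⊔ Submodule.span ℤ (translates c S') := by
  rcases Nat.even_or_odd (Fintype.card A) with hev | hodd
  · exact exists_gfaces_generate_even D hc2 hev h3
  · exact exists_gfaces_generate D hc2 hodd h3

/-! ## §3 The law -/

include D in
/-- **THE DICYCLIC LAW: `μ(G, c) = β(G, c) − 1` for every `(G, c)` carrying a dicyclic datum over a finite abelian group with `|A| ≥ 3`** — the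
least number of abstract rank-four faces whose base changes, together with the pairs, span `hodgeSpan c` is EXACTLY `#Block c − 1`. [folklore] -/
theorem isLeast_card_gfaces_generate' (hc2 : c * c = 1) (h3 : 3 ≤ Fintype.card A) :
    IsLeast {m : ℕ | ∃ S : Finset (CMF G c →₀ ℤ), ↑S ⊆ gfaceSet G c hc2 ∧ S.card = m ∧
      hodgeSpan c hc2 ≤ Submodule.span ℤ (pairSet c) ⊔ Submodule.span ℤ (translates c S)} (Fintype.card (BlockParity.Block c) - 1) := by
  refine ⟨?_, le_of_mem_generating D hc2⟩
  obtain ⟨S, hS, hcard, hgen⟩ := exists_gfaces_generate' D hc2 h3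
  have hfloor := card_block_le_card_add_one_of_subset_gfaceSet D hc2 S hS hgen
  exact ⟨S, hS, by omega, hgen⟩

include D in
/-- **Exact family**: `S ⊆ gfaceSet` with `|S| + 1 = #Block c` generating, for every `A` with `|A| ≥ 3`. [folklore] -/
theorem exists_gfaces_generate_card_eq' (hc2 : c * c = 1) (h3 : 3 ≤ Fintype.card A) :
    ∃ S : Finset (CMF G c →₀ ℤ), ↑S ⊆ gfaceSet G c hc2 ∧ S.card + 1 = Fintype.card (BlockParity.Block c) ∧
      hodgeSpan c hc2 ≤ Submodule.span ℤ (pairSet c) ⊔ Submodule.span ℤ (translates c S) := by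
  obtain ⟨S, hS, hcard, hgen⟩ := exists_gfaces_generate' D hc2 h3
  have hfloor := card_block_le_card_add_one_of_subset_gfaceSet D hc2 S hS hgen
  exact ⟨S, hS, by omega, hgen⟩

end General

/-! ## §4 Rows: `A = ℤ/4` and `A = ℤ/6` -/

section Sixteen

variable {G : Type*} [Group G] [Fintype G] [DecidableEq G] {c : G} (D : Datum G c (ZMod 4))

include D in
/-- **`A = ℤ/4` (`G = ℤ/4 ⋊ ℤ/4`, order `16`): EXACTLY `18` generating abstract rank-four faces** (`β = 19`). [folklore] -/
theorem isLeast_card_gfaces_generate_eighteen (hc2 : c * c = 1) :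
    IsLeast {m : ℕ | ∃ S : Finset (CMF G c →₀ ℤ), ↑S ⊆ gfaceSet G c hc2 ∧ S.card = m ∧
      hodgeSpan c hc2 ≤ Submodule.span ℤ (pairSet c) ⊔ Submodule.span ℤ (translates c S)} 18 := by
  have h := isLeast_card_gfaces_generate' D hc2 (by rw [ZMod.card]; norm_num)
  rwa [card_block_eq_nineteen D hc2] at h

end Sixteen

section TwentyFour

variable {G : Type*} [Group G] [Fintype G] [DecidableEq G] {c : G} (D : Datum G c (ZMod 6))

include D in
/-- **`β = 178` for `A = ℤ/6`** (`G = Dic(ℤ/2 × ℤ/6, c) ≅ Dic₃ × ℤ/2` of order `24`, `c = x²` inside the `Dic₃` factor): the additive orders in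
`ℤ/6` are `1, 6, 3, 2, 3, 6`, so `β · 24 = 4⁶ + 2·4 + 4² + 2·4³ + 4² + 2·4 = 4272`. [folklore] -/
theorem card_block_eq_oneHundredSeventyEight (hc2 : c * c = 1) : Fintype.card (BlockParity.Block c) = 178 := by
  have h := card_block_mul_four_card_eq_sum D hc2
  have hcard : Fintype.card (ZMod 6) = 6 := ZMod.card 6
  have ho0 : addOrderOf (0 : ZMod 6) = 1 := addOrderOf_zero
  have ho1 : addOrderOf (1 : ZMod 6) = 6 := ZMod.addOrderOf_one 6
  have ho2 : addOrderOf (2 : ZMod 6) = 3 := by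
    have h := ZMod.addOrderOf_coe 2 (n := 6) (by norm_num)
    norm_num at h
    exact h
  have ho3 : addOrderOf (3 : ZMod 6) = 2 := by
    have h := ZMod.addOrderOf_coe 3 (n := 6) (by norm_num)
    norm_num at h
    exact h
  have ho4 : addOrderOf (4 : ZMod 6) = 3 := by
    have h := ZMod.addOrderOf_coe 4 (n := 6) (by norm_num)
    norm_num at h
    exact h
  have ho5 : addOrderOf (5 : ZMod 6) = 6 := by
    have h := ZMod.addOrderOf_coe 5 (n := 6) (by norm_num)
    norm_num at h
    exact h
  have huniv : (Finset.univ : Finset (ZMod 6)) = {0, 1, 2, 3, 4, 5} := by decide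
  rw [hcard, huniv] at h
  rw [Finset.sum_insert (by decide), Finset.sum_insert (by decide), Finset.sum_insert (by decide), Finset.sum_insert (by decide),
    Finset.sum_pair (by decide), ho0, ho1, ho2, ho3, ho4, ho5] at h
  norm_num at h
  omega

include D in
/-- **`A = ℤ/6` (`G ≅ Dic₃ × ℤ/2` of order `24`, `c = x²`): EXACTLY `177` generating abstract rank-four faces** (`β = 178`; a degree-`24` row
beyond the certified atlas). [folklore] -/
theorem isLeast_card_gfaces_generate_oneHundredSeventySeven (hc2 : c * c = 1) :
    IsLeast {m : ℕ | ∃ S : Finset (CMF G c →₀ ℤ), ↑S ⊆ gfaceSet G c hc2 ∧ S.card = m ∧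
      hodgeSpan c hc2 ≤ Submodule.span ℤ (pairSet c) ⊔ Submodule.span ℤ (translates c S)} 177 := by
  have h := isLeast_card_gfaces_generate' D hc2 (by rw [ZMod.card]; norm_num)
  rwa [card_block_eq_oneHundredSeventyEight D hc2] at h

end TwentyFour

end

end Summit.HodgeConjecture.CorCM.Census.DicyclicTwist
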